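import Summits.QuantumFields.YangMills.Theorems.LuscherReductionRunningReductionKTHandoverSeam
import Summits.QuantumFields.YangMills.Theorems.LuscherReductionRunningReductionKTRCertificateRed
import Summits.QuantumFields.YangMills.Theorems.LuscherReductionOneSiteLevelsClosed
import Summits.QuantumFields.YangMills.Theorems.LuscherReductionRunningReductionExplicitNoIntruder
import HarnessLib

/-!
# Crux RED `RunningReduction` (stmt-QuantumFields-19978), skeleton «KTR» rev 8, KT door: FAITHFULNESS —
# `RunningReduction ↔ (CoarseHandoverUpper 2 ∧ DressedRitz)`: the two remaining KT-door inputs 3a′ and `stub_dressedRitz` are JOINTLY EQUIVALENT to the crux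

Route `LuscherReduction` (rung R2b1), crux RED `RunningReduction` (stmt-QuantumFields-19978), registered skeleton «KTR» rev 8
(`pub/ym-beyond/p1-g19-files/Lines-KTR-r8.lean`, sha16 4d4e029b06d8e70b).  After the by-name closes p793691 ∕ p793699 ∕ p793706 and the hand-over seam
`…RunningReductionKTHandoverSeam` (p794134: `runningReduction_of_coarseHandoverUpper_two_dressedRitz : ⟨3a′⟩ → DressedRitz → RED`,
`coarseHandoverUpper_two_of_coarseNoIntruder`), the KT door of RED has exactly two open inputs: the RG stub 3a′ `stub_coarseHandoverUpper2`
(`CoarseHandoverUpper 2`) and `stub_dressedRitz` (= the child `DressedRitz`, stmt-QuantumFields-20205).  THIS FILE certifies that the split loses NOTHING: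

* `coarseLevels_of_runningReduction : RED → ⟨CoarseLevels⟩` — RED + the closed crux ONE give Lüscher's law N34 `FemtoLevelsOfRecord` (tree seam
  `femtoLevels_of_reduction`, precision `O(λ²)`), hence the coarse two-sided law at every `η > 0` (skeleton PART 5 §4 `coarseLevels_of_femtoLevels`, VERBATIM:
  `Cλ² ≤ ηλ` once `λ ≤ 2·lam ≤ η/max(C,1)`);
* `coarseNoIntruder_of_runningReduction : RED → ⟨CoarseNoIntruder⟩` (upper half, `TraceDoor.coarseNoIntruder_of_coarseLevels`);
* ★ `coarseHandoverUpper_two_of_runningReduction : RED → ⟨3a′⟩` (`KTCoarseHandover.coarseHandoverUpper_two_of_coarseNoIntruder`, COARSE-LOWER(2) inside) — RED's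
  registered stub 3a′ is NECESSARY for RED;
* ★★★ `runningReduction_iff_coarseHandoverUpper_two_and_dressedRitz : RED ↔ (⟨3a′⟩ ∧ DressedRitz)` — with `KTRCalibration.dressedRitz_of_runningReduction_unconditional`
  (RED ⟹ the `DressedRitz` text, exact eigenfunctions as witnesses) and p794134's composition.  So the KT door {3a′, `stub_dressedRitz`} of skeleton «KTR» r8 is a
  LOSSLESS split of the crux: neither input is stronger than RED, and together they are RED.  (The TT door {`TwistedTraceScaling`, `DressedRitz`} is sufficient —
  `TraceDoor.runningReduction_of_twistedTraceScaling_dressedRitz` — and `TwistedTraceScaling ⟹ 3a′` (p794134); the converse RED ⟹ `TwistedTraceScaling` is NOT claimed: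
  the trace law needs the `k`-uniform femto Weyl bound, `UTD.upperTraceLaw_of_coarseLevels`.)

* `coarseHandoverUpper_two_of_explicitNoIntruder : (∀ k, ExplicitNoIntruder k) → ⟨3a′⟩` and ★ `runningReduction_of_explicitNoIntruder_dressedRitz :
  (∀ k, ExplicitNoIntruder k) → DressedRitz → RED` — the EXPLICIT way in of the skeleton (PART 4 §9 `RunningReduction_of_explicit8`) over tree names: RED's fifth
  registered stub `stub_explicitNoIntruder` (`Stmt.stub_explicitNoIntruder := ∀ k, ExplicitNoIntruder k`, the tree predicate of `…ExplicitNoIntruderDefs`) implies 3a′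
  (`coarseNoIntruder_of_explicit` + p794134) and, with the child `DressedRitz`, RED.  DAG of RED's four open registered stubs after this hand:
  `stub_twistedTraceScaling ⟹ 3a′`, `stub_explicitNoIntruder ⟹ 3a′`, `RED ⟺ 3a′ ∧ stub_dressedRitz`.

Texts `⟨CoarseLevels⟩`, `⟨CoarseNoIntruder⟩`, `⟨3a′⟩ = CoarseHandoverUpper 2` are spelled out VERBATIM from the skeleton; no definitions.

HONEST FRAMING: pure real bookkeeping among OPEN statements on the femto rung R2b1 of the CONDITIONAL Lüscher reduction route; 3a′, `DressedRitz`,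
`TwistedTraceScaling`, `ExplicitNoIntruder` and RED stay OPEN; nothing here bears on infinite volume, the continuum limit, a mass gap or Clay.  Sorry-free, no
definitions, no named-fact hypotheses (the hypotheses are the route's own decls).
-/

set_option autoImplicit false

noncomputable section

open MeasureTheory Filter Topology Real
open Literature.MathematicalPhysics.QuantumFieldTheory hiding SU2

namespace Summit.QuantumFields.YangMills.Theorems.FemtoTransferGap.KTCoarseHandover

open Summit.QuantumFields.YangMills.Theorems.FemtoTransferGap
open Summit.QuantumFields.YangMills.Theorems.FemtoTransferGap.TwoLattice

/-! ## §1 RED ⟹ the coarse two-sided Lüscher law (through N34 and the closed crux ONE) -/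

/-- **`RunningReduction → CoarseLevels`**: RED (stmt-QuantumFields-19978) and the CLOSED crux ONE (`oneSiteLevels_proof`, stmt-QuantumFields-20007) give Lüscher's law
N34 `FemtoLevelsOfRecord` (tree seam `femtoLevels_of_reduction`, precision `Cλ²/L` in the exponent), and `Cλ² ≤ ηλ` once `λ ≤ 2·lam ≤ η/max(C,1)` (skeleton «KTR» r8
PART 5 §4 `coarseLevels_of_femtoLevels`, VERBATIM). [cite: Luscher1983, §1] [cite: LuscherMunster1984, §2] -/
theorem coarseLevels_of_runningReduction (hRED : Summit.QuantumFields.YangMills.Theses.LuscherReduction.RunningReduction) :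
    ∀ k : ℕ, ∀ η : ℝ, 0 < η → ∃ lam0 : ℝ, 0 < lam0 ∧ ∀ lam : ℝ, 0 < lam → lam ≤ lam0 →
      ∃ L0 : ℕ, ∀ (L : ℕ) [NeZero L], L0 ≤ L → ∀ β : ℝ, InFemtoWindow lam β L →
        Real.exp (-((levelGap k + η) * luscherLambda β L) / L) * levelValue su2Rep L β 0 ≤ levelValue su2Rep L β k ∧
          levelValue su2Rep L β k ≤ Real.exp (-((levelGap k - η) * luscherLambda β L) / L) * levelValue su2Rep L β 0 := by
  -- adapted from the registered skeleton `Lines-KTR-r8.lean` PART 5 §4 `coarseLevels_of_femtoLevels` (owner ym-beyond-p1 g18)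
  have h : FemtoLevelsOfRecord :=
    femtoLevels_of_reduction Summit.QuantumFields.YangMills.Theorems.FemtoTransferGap.oneSiteLevels_proof hRED
  intro k η hη
  obtain ⟨C, lam0, hlam0, H⟩ := h k
  have hC1 : 0 < max C 1 := lt_of_lt_of_le one_pos (le_max_right _ _)
  refine ⟨min lam0 (η / (2 * max C 1)), lt_min hlam0 (by positivity), fun lam hlam hle => ?_⟩
  obtain ⟨L0, HL⟩ := H lam hlam (hle.trans (min_le_left _ _))
  refine ⟨L0, fun L _ hL β hW => ?_⟩
  obtain ⟨hup, hlow⟩ := HL L hL β hW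
  have hl : 0 < luscherLambda β L := luscherLambda_pos_of_window hlam hW
  have hL0 : (0 : ℝ) < (L : ℝ) := by exact_mod_cast Nat.pos_of_ne_zero (NeZero.ne L)
  have hβ : (0 : ℝ) ≤ β := zero_le_one.trans hW.1
  have hv0 : 0 ≤ levelValue su2Rep L β 0 := levelValue_su2Rep_nonneg L hβ 0
  have hle2 : lam ≤ η / (2 * max C 1) := hle.trans (min_le_right _ _)
  have hCl : C * luscherLambda β L ≤ η := by
    calc C * luscherLambda β L ≤ max C 1 * luscherLambda β L :=
          mul_le_mul_of_nonneg_right (le_max_left _ _) hl.le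
      _ ≤ max C 1 * (2 * lam) := mul_le_mul_of_nonneg_left hW.2.2 hC1.le
      _ ≤ max C 1 * (2 * (η / (2 * max C 1))) := by gcongr
      _ = η := by field_simp
  have hkey : C * luscherLambda β L ^ 2 ≤ η * luscherLambda β L := by
    have : C * luscherLambda β L ^ 2 = (C * luscherLambda β L) * luscherLambda β L := by ring
    rw [this]
    exact mul_le_mul_of_nonneg_right hCl hl.le
  constructor
  · -- lower: e^{−((Δ+η)λ)/L} λ₀ ≤ e^{−(Δλ + Cλ²)/L} λ₀ ≤ λ_k
    refine le_trans ?_ hlow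
    apply mul_le_mul_of_nonneg_right _ hv0
    apply Real.exp_le_exp.mpr
    apply div_le_div_of_nonneg_right _ hL0.le
    nlinarith
  · -- upper: λ_k ≤ e^{−(Δλ − Cλ²)/L} λ₀ ≤ e^{−((Δ−η)λ)/L} λ₀
    refine le_trans hup ?_
    apply mul_le_mul_of_nonneg_right _ hv0
    apply Real.exp_le_exp.mpr
    apply div_le_div_of_nonneg_right _ hL0.le
    nlinarith

/-- **`RunningReduction → CoarseNoIntruder`** (KT's former global stub 3 is NECESSARY for RED): the upper half of `coarseLevels_of_runningReduction` at `η = Δ_k − d`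
(`TraceDoor.coarseNoIntruder_of_coarseLevels`). [cite: Luscher1983, §1] -/
theorem coarseNoIntruder_of_runningReduction (hRED : Summit.QuantumFields.YangMills.Theses.LuscherReduction.RunningReduction) :
    ∀ k : ℕ, ∀ d : ℝ, d < levelGap k → ∃ lam0 : ℝ, 0 < lam0 ∧ ∀ lam : ℝ, 0 < lam → lam ≤ lam0 →
      ∃ L0 : ℕ, ∀ (L : ℕ) [NeZero L], L0 ≤ L → ∀ β : ℝ, InFemtoWindow lam β L →
        levelValue su2Rep L β k ≤ Real.exp (-(d * luscherLambda β L) / L) * levelValue su2Rep L β 0 :=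
  TraceDoor.coarseNoIntruder_of_coarseLevels (coarseLevels_of_runningReduction hRED)

/-- ★ **`RunningReduction → CoarseHandoverUpper 2`**: RED's registered stub 3a′ `stub_coarseHandoverUpper2` (UV′-upper: one-sided cutoff universality of the femto
spectrum at matched two-loop label, fine `L` versus coarse `2`) is NECESSARY for RED (`coarseHandoverUpper_two_of_coarseNoIntruder`, p794134: faithfulness with
COARSE-LOWER(2) `TwoLattice.Base.coarseLower_all 2` inside). [cite: Luscher1983, §3] [cite: LuscherMunster1984, §2] -/
theorem coarseHandoverUpper_two_of_runningReduction (hRED : Summit.QuantumFields.YangMills.Theses.LuscherReduction.RunningReduction) :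
    ∀ k : ℕ, ∀ ε : ℝ, 0 < ε → ∃ lam0 : ℝ, 0 < lam0 ∧ ∀ lam : ℝ, 0 < lam → lam ≤ lam0 →
      ∃ L1 : ℕ, ∀ (L : ℕ) [NeZero L], L1 ≤ L → ∀ β : ℝ, InFemtoWindow lam β L →
        ∀ β' : ℝ, 1 ≤ β' → luscherLambda β' 2 = luscherLambda β L →
          levelValue su2Rep L β k ^ L * levelValue su2Rep 2 β' 0 ^ 2 ≤
            Real.exp (ε * luscherLambda β L) * (levelValue su2Rep 2 β' k ^ 2 * levelValue su2Rep L β 0 ^ L) :=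
  coarseHandoverUpper_two_of_coarseNoIntruder (coarseNoIntruder_of_runningReduction hRED)

/-! ## §2 ★★★ The KT door is a lossless split of RED -/

/-- ★★★ **`RunningReduction ↔ (CoarseHandoverUpper 2 ∧ DressedRitz)`** — the two remaining inputs of the KT door of skeleton «KTR» r8 (registered stubs 3a′
`stub_coarseHandoverUpper2` and `stub_dressedRitz` = the child crux `DressedRitz`, stmt-QuantumFields-20205) are JOINTLY EQUIVALENT to the crux RED
(stmt-QuantumFields-19978): `→` by `coarseHandoverUpper_two_of_runningReduction` and `KTRCalibration.dressedRitz_of_runningReduction_unconditional` (exact zero-flux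
eigenfunctions as the dressed Ritz family); `←` by `runningReduction_of_coarseHandoverUpper_two_dressedRitz` (p794134: hand-over seam + the tree's KT composition
`TraceDoor.runningReduction_of_coarseNoIntruder`).  Neither input alone is claimed to give RED. [cite: Luscher1983, §3] [cite: Kato1949, Lemma 2, Thm 1]
[cite: LuscherMunster1984, §2] -/
theorem runningReduction_iff_coarseHandoverUpper_two_and_dressedRitz :
    Summit.QuantumFields.YangMills.Theses.LuscherReduction.RunningReduction ↔
      ((∀ k : ℕ, ∀ ε : ℝ, 0 < ε → ∃ lam0 : ℝ, 0 < lam0 ∧ ∀ lam : ℝ, 0 < lam → lam ≤ lam0 →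
        ∃ L1 : ℕ, ∀ (L : ℕ) [NeZero L], L1 ≤ L → ∀ β : ℝ, InFemtoWindow lam β L →
          ∀ β' : ℝ, 1 ≤ β' → luscherLambda β' 2 = luscherLambda β L →
            levelValue su2Rep L β k ^ L * levelValue su2Rep 2 β' 0 ^ 2 ≤
              Real.exp (ε * luscherLambda β L) * (levelValue su2Rep 2 β' k ^ 2 * levelValue su2Rep L β 0 ^ L)) ∧
        Summit.QuantumFields.YangMills.Theses.LuscherReduction.DressedRitz) := by
  constructor
  · intro hRED
    refine ⟨coarseHandoverUpper_two_of_runningReduction hRED, ?_⟩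
    unfold Summit.QuantumFields.YangMills.Theses.LuscherReduction.DressedRitz
    exact KTRCalibration.dressedRitz_of_runningReduction_unconditional hRED
  · rintro ⟨hU, hDR⟩
    exact runningReduction_of_coarseHandoverUpper_two_dressedRitz hU hDR

/-! ## §3 The EXPLICIT way in (skeleton PART 4 §9) over tree names -/

/-- **`(∀ k, ExplicitNoIntruder k) → CoarseHandoverUpper 2`**: RED's fifth registered stub `stub_explicitNoIntruder` implies its stub 3a′ (tree
`coarseNoIntruder_of_explicit`, then `coarseHandoverUpper_two_of_coarseNoIntruder`, p794134). [cite: Luscher1983, §3] [cite: LuscherMunster1984, §2] -/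
theorem coarseHandoverUpper_two_of_explicitNoIntruder (hX : ∀ k, ExplicitNoIntruder k) :
    ∀ k : ℕ, ∀ ε : ℝ, 0 < ε → ∃ lam0 : ℝ, 0 < lam0 ∧ ∀ lam : ℝ, 0 < lam → lam ≤ lam0 →
      ∃ L1 : ℕ, ∀ (L : ℕ) [NeZero L], L1 ≤ L → ∀ β : ℝ, InFemtoWindow lam β L →
        ∀ β' : ℝ, 1 ≤ β' → luscherLambda β' 2 = luscherLambda β L →
          levelValue su2Rep L β k ^ L * levelValue su2Rep 2 β' 0 ^ 2 ≤
            Real.exp (ε * luscherLambda β L) * (levelValue su2Rep 2 β' k ^ 2 * levelValue su2Rep L β 0 ^ L) :=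
  coarseHandoverUpper_two_of_coarseNoIntruder (coarseNoIntruder_of_explicit hX)

/-- ★ **The EXPLICIT way in, unconditional in ONE (skeleton «KTR» r8 PART 4 §9 `RunningReduction_of_explicit8` over tree names):
`(∀ k, ExplicitNoIntruder k) → DressedRitz → RunningReduction`** — RED's registered stubs `stub_explicitNoIntruder` and `stub_dressedRitz` close the crux BY NAME
(tree `coarseNoIntruder_of_explicit` + `TraceDoor.runningReduction_of_coarseNoIntruder`). [cite: Luscher1983, §3] [cite: Kato1949, Lemma 2, Thm 1] -/
theorem runningReduction_of_explicitNoIntruder_dressedRitz (hX : ∀ k, ExplicitNoIntruder k)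
    (hDR : Summit.QuantumFields.YangMills.Theses.LuscherReduction.DressedRitz) :
    Summit.QuantumFields.YangMills.Theses.LuscherReduction.RunningReduction :=
  TraceDoor.runningReduction_of_coarseNoIntruder (coarseNoIntruder_of_explicit hX) hDR

end Summit.QuantumFields.YangMills.Theorems.FemtoTransferGap.KTCoarseHandover

end
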